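import Literature.Algebra.Module.LoewySeriesIterate
import HarnessLib

/-!
# Strictness and stabilisation of the Loewy series; the radical series of a quotient: `ℓℓ(M / radⁱ M) = min(i, ℓℓ M)`
# (Assem–Simson–Skowroński V.1 Lemma 1.1, Prop. 1.3; Anderson–Fuller §32)

Family `hodge`, lane `lit-hodgefound` (foundations library; seat `lit-hodgefound-p39`, generation 35, row g35-#1); topic `Algebra/Module`,
namespace `Literature.Algebra.Module.SocleRadical` (continued).  Sequel of `LoewySeries` (g33-#14: `socleSeries`, `radicalSeries`, `loewyLength`,
`socleSeries_lt_succ` for Artinian modules), `LoewySeriesLattice` (g34-#1: the lattice recursions `socⁿ⁺¹ = socⁿ ⊔ ⋁ covers`,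
`radⁿ⁺¹ = radⁿ ⊓ ⋀ co-covers`), `SocleSeriesFunctorial` (g34-#4) and `LoewySeriesIterate` (g34-#9: `ℓℓ(radⁱ M) = ℓℓ(M) − i`,
`ht(M / socⁱ M) = ht(M) − i`) over an ARBITRARY ring `R`.

Anderson–Fuller [AndersonFuller1992, §32 (p. 346)] on the Loewy factors `radᵏ M / radᵏ⁺¹ M` and `socᵏ⁺¹ M / socᵏ M` of a module of finite
Loewy length: «Each of these factors is semisimple and none are zero (unless `M` is)».  Assem–Simson–Skowroński [AssemSkowronskiSimson2006,
V.1 Lemma 1.1]: «Let `f : M_A → N_A` be an `A`-module epimorphism. Then `f(radⁱ M) = radⁱ N` for every `i ≥ 0`», and in the proof of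
[AssemSkowronskiSimson2006, V.1 Prop. 1.3]: «`rℓ(M) = j = 1 + rℓ(M / rad^{j−1} M)`».  What is formalised here, for the LATTICE-theoretic
radical of Mathlib (`Module.jacobson`, the intersection of the maximal submodules) over an arbitrary ring:

* §1 STABILISATION (every module): **`socᵏ M = socᵏ⁺¹ M ⟹ socᵏ⁺ʲ M = socᵏ M`** and **`radᵏ⁺¹ M = radᵏ M ⟹ radᵏ⁺ʲ M = radᵏ M`** (the series are
  obtained by iterating a lattice operation, g34-#1), hence STRICTNESS below termination: if some `radⁿ M = 0` then `radᵏ M ≠ 0 ⟹ radᵏ⁺¹ M < radᵏ M`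
  («none are zero»), dually for the socle series; unconditionally the radical series of a NOETHERIAN module decreases strictly while non-zero
  (a non-zero finitely generated module has a maximal submodule — the dual of g33-#14 `socleSeries_lt_succ` for Artinian modules).
* §2 ASS V.1 Lemma 1.1 in the HONEST module-theoretic form **`g(radᵏ M) = radᵏ N` for `g : M ↠ N` with `ker g ≤ radⁱ M` and `k ≤ i`**
  (`map_radicalSeries_eq_of_ker_le`); over a finite-dimensional algebra `rad M = M·rad A` (ASS I.3.7 (d)) makes the kernel hypothesis void —
  for Mathlib's radical over an arbitrary ring it is NECESSARY (`ℤ ↠ ℤ/4ℤ`: `rad ℤ = 0` but `rad(ℤ/4ℤ) = 2ℤ/4ℤ`); the hypothesis-free form over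
  rings semisimple modulo the radical is the sequel g35-#2.  Hence **`radᵏ(M/K) = (radᵏ M + K)/K` for `K ≤ radⁱ M`, `k ≤ i`**, in particular
  `radᵏ(M / radⁱ M) = radᵏ M / radⁱ M` and `radⁱ(M / radⁱ M) = 0`.
* §3 for `M` of finite length **`ℓℓ(M / radⁱ M) = min(i, ℓℓ M)`** (`loewyLength_quotient_radicalSeries`; ASS's «`rℓ(M) = 1 + rℓ(M/rad^{j−1}M)`»),
  completing the quartet with g34-#9 `ℓℓ(radⁱ M) = ℓℓ M − i`, `ht(M/socⁱ M) = ht M − i` and g34-#13 `ht(socʲ M) = j`; and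
  `min(i, ℓℓ M) ≤ ℓℓ(M/K) ≤ ℓℓ M` for every `K ≤ radⁱ M`.

Theorems only, 0 `sorry`, no definition, no named fact (net debt 0, D-0026), no instance, no notation.

## Mathlib / Literature search

Mathlib: `Module.map_jacobson_of_ker_le` (the one-step case `k = i = 1`), `Module.jacobson_lt_top` (`[Nontrivial] [IsCoatomic]`), `LinearMap.restrict`,
`LinearMap.le_ker_iff_map`, `Submodule.factor(_surjective)`, `Submodule.mkQ_map_self`; no socle/radical series in Mathlib.  Literature (this seat):
g33-#14 `radicalSeries_succ`, `mem_radicalSeries_succ_iff`, `radicalSeries_antitone`, `socleSeries_mono`, `radicalSeries_eq_bot_iff_loewyLength_le`,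
`radicalSeries_loewyLength`; g34-#1 `socleSeries_succ_eq_sup_sSup`, `radicalSeries_succ_eq_inf_sInf`; g34-#4 `loewyLength_le_of_surjective`,
`loewyLength_quotient_le`.  `rg -n 'radicalSeries_succ_lt|loewyLength_quotient_radicalSeries|map_radicalSeries_eq_of_ker_le'` over `Literature` →
nothing before this file.

## References

* I. Assem, D. Simson, A. Skowroński, *Elements of the Representation Theory of Associative Algebras 1*, LMS Student Texts 65, CUP (2006), V.1
  Lemma 1.1, Cor. 1.2, Prop. 1.3 (pp. 160–162); I.3.7 (d). [AssemSkowronskiSimson2006]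
* F. W. Anderson, K. R. Fuller, *Rings and Categories of Modules*, 2nd ed., GTM 13 (1992), §32 (p. 346); §9 Prop. 9.15. [AndersonFuller1992]
* H. Krause, *Homological Theory of Representations*, CUP (2021), Conventions and Notations (p. xxiv «Socle», «Radical»). [Krause2021]
-/

open Submodule

namespace Literature.Algebra.Module

namespace SocleRadical

variable {R : Type*} [Ring R] {M : Type*} [AddCommGroup M] [Module R M] {N : Type*} [AddCommGroup N] [Module R N]

/-! ## §1 Stabilisation and strictness of the two series -/

/-- **`socᵏ M = socᵏ⁺¹ M ⟹ socᵏ⁺ʲ M = socᵏ M`**: the socle series is obtained by iterating the lattice operation `X ↦ X ⊔ ⋁{N | X ⋖ N}` (g34-#1),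
so it is constant after its first repetition. [cite: Krause2021, Conventions «Socle»] [cite: AndersonFuller1992, §32 (p. 346)] -/
theorem socleSeries_add_eq_of_eq_succ {k : ℕ} (h : socleSeries R M k = socleSeries R M (k + 1)) (j : ℕ) :
    socleSeries R M (k + j) = socleSeries R M k := by
  induction j with
  | zero => rfl
  | succ j ih => rw [← Nat.add_assoc, socleSeries_succ_eq_sup_sSup R M (k + j), ih, ← socleSeries_succ_eq_sup_sSup R M k, ← h]

/-- **`radᵏ⁺¹ M = radᵏ M ⟹ radᵏ⁺ʲ M = radᵏ M`**: the radical series iterates `X ↦ X ⊓ ⋀{N | N ⋖ X}` (g34-#1).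
[cite: Krause2021, Conventions «Radical»] [cite: AndersonFuller1992, §32 (p. 346)] -/
theorem radicalSeries_add_eq_of_succ_eq {k : ℕ} (h : radicalSeries R M (k + 1) = radicalSeries R M k) (j : ℕ) :
    radicalSeries R M (k + j) = radicalSeries R M k := by
  induction j with
  | zero => rfl
  | succ j ih => rw [← Nat.add_assoc, radicalSeries_succ_eq_inf_sInf R M (k + j), ih, ← radicalSeries_succ_eq_inf_sInf R M k, h]

/-- A stationary socle series that reaches `M` is already there: `socᵏ M = socᵏ⁺¹ M` and `socⁿ M = M` force `socᵏ M = M`.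
[cite: Krause2021, Conventions «Socle»] [cite: AndersonFuller1992, §32 (p. 346)] -/
theorem socleSeries_eq_top_of_eq_succ {k n : ℕ} (h : socleSeries R M k = socleSeries R M (k + 1)) (hn : socleSeries R M n = ⊤) :
    socleSeries R M k = ⊤ := by
  rw [← socleSeries_add_eq_of_eq_succ h n]
  exact top_le_iff.mp (hn.ge.trans (socleSeries_mono R M (Nat.le_add_left n k)))

/-- Dually `radᵏ⁺¹ M = radᵏ M` and `radⁿ M = 0` force `radᵏ M = 0`. [cite: Krause2021, Conventions «Radical»] [cite: AndersonFuller1992, §32 (p. 346)] -/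
theorem radicalSeries_eq_bot_of_succ_eq {k n : ℕ} (h : radicalSeries R M (k + 1) = radicalSeries R M k) (hn : radicalSeries R M n = ⊥) :
    radicalSeries R M k = ⊥ := by
  rw [← radicalSeries_add_eq_of_succ_eq h n]
  exact le_bot_iff.mp ((radicalSeries_antitone R M (Nat.le_add_left n k)).trans hn.le)

/-- **«None of the Loewy factors are zero»**, radical form: if the radical series reaches `0`, it decreases STRICTLY while non-zero.
[cite: AndersonFuller1992, §32 (p. 346)] [cite: AssemSkowronskiSimson2006, V.1 (p. 160)] -/
theorem radicalSeries_succ_lt_of_exists_eq_bot (hn : ∃ n, radicalSeries R M n = ⊥) {k : ℕ} (hk : radicalSeries R M k ≠ ⊥) :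
    radicalSeries R M (k + 1) < radicalSeries R M k := by
  obtain ⟨n, hn⟩ := hn
  exact lt_of_le_of_ne (radicalSeries_succ_le R M k) fun heq => hk (radicalSeries_eq_bot_of_succ_eq heq hn)

/-- **«None of the Loewy factors are zero»**, socle form: if the socle series reaches `M`, it increases STRICTLY below `M`.
[cite: AndersonFuller1992, §32 (p. 346)] [cite: AssemSkowronskiSimson2006, V.1 (p. 160)] -/
theorem socleSeries_lt_succ_of_exists_eq_top (hn : ∃ n, socleSeries R M n = ⊤) {k : ℕ} (hk : socleSeries R M k ≠ ⊤) :
    socleSeries R M k < socleSeries R M (k + 1) := by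
  obtain ⟨n, hn⟩ := hn
  exact lt_of_le_of_ne (le_socleSeries_succ R M k) fun heq => hk (socleSeries_eq_top_of_eq_succ heq hn)

/-- The radical series of a NOETHERIAN module decreases strictly while non-zero (a non-zero finitely generated module has a maximal submodule,
so `rad P < P` for `P = radᵏ M ≠ 0`); no termination hypothesis.  Dual of g33-#14 `socleSeries_lt_succ` (Artinian).
[cite: Krause2021, Conventions «Radical»] [cite: AssemSkowronskiSimson2006, V.1 (p. 160)] -/
theorem radicalSeries_succ_lt [IsNoetherian R M] {k : ℕ} (hk : radicalSeries R M k ≠ ⊥) :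
    radicalSeries R M (k + 1) < radicalSeries R M k := by
  refine lt_of_le_of_ne (radicalSeries_succ_le R M k) fun heq => ?_
  haveI : Nontrivial ↥(radicalSeries R M k) := (Submodule.nontrivial_iff_ne_bot).mpr hk
  have hlt := Module.jacobson_lt_top R ↥(radicalSeries R M k)
  apply hlt.ne
  apply Submodule.map_injective_of_injective (Submodule.injective_subtype (radicalSeries R M k))
  rw [Submodule.map_top, Submodule.range_subtype, ← radicalSeries_succ, heq]

/-- For `M` of finite length: `radᵏ⁺¹ M < radᵏ M` for every `k < ℓℓ(M)`. [cite: AssemSkowronskiSimson2006, V.1 (p. 160)]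
[cite: Krause2021, Conventions «Radical»] -/
theorem radicalSeries_succ_lt_of_lt_loewyLength [IsArtinian R M] [IsNoetherian R M] {k : ℕ} (hk : k < loewyLength R M) :
    radicalSeries R M (k + 1) < radicalSeries R M k :=
  radicalSeries_succ_lt fun h => absurd (radicalSeries_eq_bot_iff_loewyLength_le.mp h) (not_le.mpr hk)

/-- For `M` of finite length: `socᵏ M < socᵏ⁺¹ M` for every `k < ht(M)`. [cite: AssemSkowronskiSimson2006, V.1 (p. 160)]
[cite: Krause2021, Conventions «Socle»] -/
theorem socleSeries_lt_succ_of_lt_socleLength [IsArtinian R M] [IsNoetherian R M] {k : ℕ} (hk : k < socleLength R M) :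
    socleSeries R M k < socleSeries R M (k + 1) :=
  socleSeries_lt_succ fun h => absurd (socleSeries_eq_top_iff_socleLength_le.mp h) (not_le.mpr hk)

/-- `radᵏ M ≠ 0` for `k < ℓℓ(M)` (every module: `ℓℓ` is an infimum). [cite: Krause2021, Conventions «Radical»] -/
theorem radicalSeries_ne_bot_of_lt_loewyLength {k : ℕ} (hk : k < loewyLength R M) : radicalSeries R M k ≠ ⊥ :=
  fun h => absurd (Nat.sInf_le (show k ∈ {n | radicalSeries R M n = ⊥} from h)) (by rw [← loewyLength_def]; exact not_le.mpr hk)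

/-- `socᵏ M ≠ M` for `k < ht(M)` (every module). [cite: Krause2021, Conventions «Socle»] -/
theorem socleSeries_ne_top_of_lt_socleLength {k : ℕ} (hk : k < socleLength R M) : socleSeries R M k ≠ ⊤ :=
  fun h => absurd (Nat.sInf_le (show k ∈ {n | socleSeries R M n = ⊤} from h)) (by rw [← socleLength_def]; exact not_le.mpr hk)

/-- In a module of finite length two terms of the radical series below the Loewy length coincide only when their indices do:
`radᵏ M = radˡ M`, `k, l ≤ ℓℓ(M)` ⟹ `k = l`. [cite: AssemSkowronskiSimson2006, V.1 (p. 160)] [cite: Krause2021, Conventions «Radical»] -/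
theorem radicalSeries_injOn_of_le_loewyLength [IsArtinian R M] [IsNoetherian R M] {k l : ℕ} (hk : k ≤ loewyLength R M)
    (hl : l ≤ loewyLength R M) (h : radicalSeries R M k = radicalSeries R M l) : k = l := by
  by_contra hne
  wlog hkl : k < l generalizing k l
  · exact this hl hk h.symm (Ne.symm hne) (lt_of_le_of_ne (not_lt.mp hkl) (Ne.symm hne))
  -- `rad^l ≤ rad^{k+1} < rad^k = rad^l`
  have h1 : radicalSeries R M l ≤ radicalSeries R M (k + 1) := radicalSeries_antitone R M hkl
  have h2 := radicalSeries_succ_lt_of_lt_loewyLength (R := R) (M := M) (lt_of_lt_of_le hkl hl)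
  exact absurd (h1.trans_lt h2) (by rw [h]; exact lt_irrefl _)

/-! ## §2 The radical series along a surjection with small kernel; the radical series of a quotient -/

/-- **Assem–Simson–Skowroński V.1 Lemma 1.1 (module-theoretic form): `g(radᵏ M) = radᵏ N` for a SURJECTION `g : M ↠ N` whose kernel lies in
`radⁱ M`, for every `k ≤ i`.**  Induction on `k`: `g` restricts to a surjection `radᵏ M ↠ radᵏ N` whose kernel `ker g ∩ radᵏ M ≤ radⁱ M ≤ radᵏ⁺¹ M
= rad(radᵏ M)` is small, so it maps `rad(radᵏ M)` onto `rad(radᵏ N)` (Mathlib `Module.map_jacobson_of_ker_le`, Anderson–Fuller 9.15).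
[cite: AssemSkowronskiSimson2006, V.1 Lemma 1.1 (p. 160)] [cite: AndersonFuller1992, §9 Prop. 9.15] -/
theorem map_radicalSeries_eq_of_ker_le (g : M →ₗ[R] N) (hg : Function.Surjective g) {i : ℕ} (hker : LinearMap.ker g ≤ radicalSeries R M i) :
    ∀ k ≤ i, (radicalSeries R M k).map g = radicalSeries R N k := by
  intro k
  induction k with
  | zero =>
    intro _
    rw [radicalSeries_zero, radicalSeries_zero, Submodule.map_top, LinearMap.range_eq_top.mpr hg]
  | succ k ih =>
    intro hk
    have ih' := ih (Nat.le_of_succ_le hk)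
    have hPQ : ∀ x ∈ radicalSeries R M k, g x ∈ radicalSeries R N k := fun x hx => ih' ▸ Submodule.mem_map_of_mem hx
    -- the restriction `g' : radᵏ M ↠ radᵏ N`
    have hg' : Function.Surjective (g.restrict hPQ) := by
      rintro ⟨y, hy⟩
      rw [← ih'] at hy
      obtain ⟨x, hx, rfl⟩ := hy
      exact ⟨⟨x, hx⟩, rfl⟩
    have hker' : LinearMap.ker (g.restrict hPQ) ≤ Module.jacobson R ↥(radicalSeries R M k) := by
      intro x hx
      have hx0 : g (x : M) = 0 := by
        rw [LinearMap.mem_ker] at hx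
        simpa using congrArg Subtype.val hx
      have hxi : (x : M) ∈ radicalSeries R M (k + 1) := radicalSeries_antitone R M hk (hker hx0)
      obtain ⟨_, hxJ⟩ := mem_radicalSeries_succ_iff.mp hxi
      exact hxJ
    have hmap := Module.map_jacobson_of_ker_le hg' hker'
    rw [radicalSeries_succ, radicalSeries_succ, ← hmap, ← Submodule.map_comp, ← Submodule.map_comp]
    rfl

/-- **`radᵏ(M/K) = (radᵏ M + K)/K` — the image of `radᵏ M` in `M/K` — for `K ≤ radⁱ M` and `k ≤ i`.**
[cite: AssemSkowronskiSimson2006, V.1 Lemma 1.1 (p. 160)] [cite: AndersonFuller1992, §9 Prop. 9.15] -/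
theorem radicalSeries_quotient_eq_map_of_le {K : Submodule R M} {i : ℕ} (hK : K ≤ radicalSeries R M i) {k : ℕ} (hk : k ≤ i) :
    radicalSeries R (M ⧸ K) k = (radicalSeries R M k).map K.mkQ :=
  (map_radicalSeries_eq_of_ker_le K.mkQ (Submodule.mkQ_surjective K) (by rwa [Submodule.ker_mkQ]) k hk).symm

variable (R M) in
/-- `radᵏ(M / radⁱ M) = radᵏ M / radⁱ M` for `k ≤ i`. [cite: AssemSkowronskiSimson2006, V.1 Lemma 1.1, proof of Prop. 1.3 (pp. 160–162)] -/
theorem radicalSeries_quotient_radicalSeries {i k : ℕ} (hk : k ≤ i) :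
    radicalSeries R (M ⧸ radicalSeries R M i) k = (radicalSeries R M k).map (radicalSeries R M i).mkQ :=
  radicalSeries_quotient_eq_map_of_le le_rfl hk

variable (R M) in
/-- `radⁱ(M / radⁱ M) = 0`. [cite: AssemSkowronskiSimson2006, V.1 proof of Prop. 1.3 (p. 162)] -/
theorem radicalSeries_quotient_radicalSeries_self (i : ℕ) : radicalSeries R (M ⧸ radicalSeries R M i) i = ⊥ := by
  rw [radicalSeries_quotient_radicalSeries R M le_rfl, Submodule.mkQ_map_self]

variable (R M) in
/-- `radᵏ(M / radⁱ M) = 0` for every `k ≥ i`. [cite: AssemSkowronskiSimson2006, V.1 proof of Prop. 1.3 (p. 162)] -/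
theorem radicalSeries_quotient_radicalSeries_eq_bot {i k : ℕ} (hk : i ≤ k) : radicalSeries R (M ⧸ radicalSeries R M i) k = ⊥ :=
  le_bot_iff.mp ((radicalSeries_antitone R _ hk).trans (radicalSeries_quotient_radicalSeries_self R M i).le)

/-- For `K ≤ radⁱ M` and `k ≤ i`: `radᵏ(M/K) = 0 ⟺ radᵏ M ≤ K`. [cite: AssemSkowronskiSimson2006, V.1 Lemma 1.1 (p. 160)] -/
theorem radicalSeries_quotient_eq_bot_iff_of_le {K : Submodule R M} {i : ℕ} (hK : K ≤ radicalSeries R M i) {k : ℕ} (hk : k ≤ i) :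
    radicalSeries R (M ⧸ K) k = ⊥ ↔ radicalSeries R M k ≤ K := by
  rw [radicalSeries_quotient_eq_map_of_le hK hk, ← LinearMap.le_ker_iff_map, Submodule.ker_mkQ]

/-- A submodule `K ≤ radⁱ M` containing `radᵏ M` with `k ≤ i` squeezes the series: `radᵏ M = radⁱ M` (hence `K = radⁱ M`).
[cite: Krause2021, Conventions «Radical»] -/
theorem radicalSeries_eq_of_le_of_le {K : Submodule R M} {i k : ℕ} (hK : K ≤ radicalSeries R M i) (hk : k ≤ i)
    (h : radicalSeries R M k ≤ K) : radicalSeries R M k = radicalSeries R M i :=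
  le_antisymm (h.trans hK) (radicalSeries_antitone R M hk)

/-! ## §3 The Loewy length of `M / radⁱ M` and of quotients by small submodules (finite length) -/

variable (R M) in
/-- **`ℓℓ(M / radⁱ M) = min(i, ℓℓ M)`** for `M` of finite length: `radᵏ(M/radⁱ M) = radᵏ M / radⁱ M` vanishes iff `radᵏ M = radⁱ M`, which below
the Loewy length happens only for `k = i` (strictness), and from `i` on always.  Assem–Simson–Skowroński: «`rℓ(M) = j = 1 + rℓ(M/rad^{j−1} M)`».
[cite: AssemSkowronskiSimson2006, V.1 proof of Prop. 1.3 (pp. 161–162)] [cite: Krause2021, Conventions «Radical»] -/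
theorem loewyLength_quotient_radicalSeries [IsArtinian R M] [IsNoetherian R M] (i : ℕ) :
    loewyLength R (M ⧸ radicalSeries R M i) = min i (loewyLength R M) := by
  refine eq_of_forall_ge_iff fun k => ?_
  rw [← radicalSeries_eq_bot_iff_loewyLength_le, min_le_iff]
  constructor
  · intro h
    rcases le_or_gt i k with hik | hki
    · exact Or.inl hik
    · -- `k < i`: `radᵏ M ≤ radⁱ M ≤ radᵏ⁺¹ M`, so the series is stationary at `k` and `radᵏ M = 0`
      right
      rw [radicalSeries_quotient_eq_bot_iff_of_le le_rfl hki.le] at h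
      have hst : radicalSeries R M (k + 1) = radicalSeries R M k :=
        le_antisymm (radicalSeries_succ_le R M k) (h.trans (radicalSeries_antitone R M hki))
      exact radicalSeries_eq_bot_iff_loewyLength_le.mp (radicalSeries_eq_bot_of_succ_eq hst (radicalSeries_loewyLength R M))
  · rintro (hik | hk)
    · exact radicalSeries_quotient_radicalSeries_eq_bot R M hik
    · rcases le_or_gt k i with hki | hik
      · rw [radicalSeries_quotient_radicalSeries R M hki, radicalSeries_eq_bot_iff_loewyLength_le.mpr hk, Submodule.map_bot]
      · exact radicalSeries_quotient_radicalSeries_eq_bot R M hik.le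

variable (R M) in
/-- **`ℓℓ(M / radⁱ M) = i` for `i ≤ ℓℓ(M)`** (finite length). [cite: AssemSkowronskiSimson2006, V.1 proof of Prop. 1.3 (pp. 161–162)]
[cite: Krause2021, Conventions «Radical»] -/
theorem loewyLength_quotient_radicalSeries_of_le [IsArtinian R M] [IsNoetherian R M] {i : ℕ} (hi : i ≤ loewyLength R M) :
    loewyLength R (M ⧸ radicalSeries R M i) = i := by
  rw [loewyLength_quotient_radicalSeries, min_eq_left hi]

variable (R M) in
/-- `ℓℓ(M / rad M) ≤ 1` and `= 1` as soon as `M ≠ 0` (finite length): the top is semisimple. [cite: AssemSkowronskiSimson2006, V.1 (p. 161)]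
[cite: Krause2021, Conventions «Radical»] -/
theorem loewyLength_quotient_jacobson [IsArtinian R M] [IsNoetherian R M] :
    loewyLength R (M ⧸ Module.jacobson R M) = min 1 (loewyLength R M) := by
  rw [← radicalSeries_one, loewyLength_quotient_radicalSeries]

/-- **`min(i, ℓℓ M) ≤ ℓℓ(M/K)` for every `K ≤ radⁱ M`** (finite length): `M / radⁱ M` is a quotient of `M/K` (and `ℓℓ(M/K) ≤ ℓℓ M` is g34-#4
`loewyLength_quotient_le`). [cite: AssemSkowronskiSimson2006, V.1 Cor. 1.2, Prop. 1.3 (pp. 161–162)] -/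
theorem min_loewyLength_le_loewyLength_quotient [IsArtinian R M] [IsNoetherian R M] {K : Submodule R M} {i : ℕ}
    (hK : K ≤ radicalSeries R M i) : min i (loewyLength R M) ≤ loewyLength R (M ⧸ K) := by
  rw [← loewyLength_quotient_radicalSeries R M i]
  exact loewyLength_le_of_surjective (Submodule.factor hK) (Submodule.factor_surjective hK)

/-- Hence **`ℓℓ(M/K) = ℓℓ(M)` for every `K ≤ rad^{ℓℓ M} M`** — trivially, as that term is `0`; the useful reading is `K ≤ radⁱ M` with
`i ≥ ℓℓ M`. [cite: AssemSkowronskiSimson2006, V.1 Cor. 1.2 (p. 161)] -/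
theorem loewyLength_quotient_eq_of_le_radicalSeries [IsArtinian R M] [IsNoetherian R M] {K : Submodule R M} {i : ℕ}
    (hK : K ≤ radicalSeries R M i) (hi : loewyLength R M ≤ i) : loewyLength R (M ⧸ K) = loewyLength R M :=
  le_antisymm (loewyLength_quotient_le K) (by simpa [min_eq_right hi] using min_loewyLength_le_loewyLength_quotient hK)

/-- And **`i ≤ ℓℓ(M/K)` for `K ≤ radⁱ M`, `i ≤ ℓℓ M`**: quotients by submodules deep in the radical series keep Loewy length at least `i`.
[cite: AssemSkowronskiSimson2006, V.1 Prop. 1.3 (pp. 161–162)] -/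
theorem le_loewyLength_quotient_of_le_radicalSeries [IsArtinian R M] [IsNoetherian R M] {K : Submodule R M} {i : ℕ}
    (hK : K ≤ radicalSeries R M i) (hi : i ≤ loewyLength R M) : i ≤ loewyLength R (M ⧸ K) := by
  simpa [min_eq_left hi] using min_loewyLength_le_loewyLength_quotient hK

end SocleRadical

end Literature.Algebra.Module
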